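import Literature.MathematicalPhysics.QuantumFieldTheory.Balaban1983to89.Node00.TwoRunSiteLift

/-!
# NODE 00 — PERSISTENCE AT THE TWO-RUN SITE KEY (node U5d ∕ N20's bad class, the KEY-LEVEL predicate): «the index carries an OLD
# large-field region» — `Λ_j ≠ T_η` at some level `j ≤ jcut` — read on the COUPLING-FREE KEY of `Node00/TwoRunSiteKey`, so that the bad
# class of N20's `RelWeightBound` and the good class of N19's core edge are ONE set of keys for BOTH runs; what each run's keyed fibre over
# a bad key consists of; the section of `Node00/TwoRunSiteLift` is exact on it

Cell `pub-ymgap`, YM-PLAN Track A (HUMAN RULING D-0062; work-bound push D-0149); seat `pub-ymgap-dag-n20-d` (R134 (a) N20 NE7b s3) gen 28 —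
continuation of `Node00/TwoRunSite{Transport,Key,Lift}` (p561554 ∕ p570161 ∕ p575738).  TYPED AS AN OFFER for plan g77's W-SEAT START LIST v2
§2 «n20 NE7b» item 2 («persistent-activity weight at the TWO-RUN SITE KEY for ONE pair of runs»); filed ONLY on plan's ∕ dag-lead's GO.
[III] = [Balaban1988Convergent], [LF-I] = [Balaban1989LargeFieldI], [LF-II] = [Balaban1989LargeFieldII].

WHY.  At N19's keyed class-weight faces (`Thm/BalabanUVNodesN19TargetClassWeightsTwoRunKeyed` :169, p571597; `…TargetKeyedUnpartnered`, p576376)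
the bad class `Bad : ℕ → ℝ → Finset (Σ K, SiteSeqKey F (K₀ + K))` is an IMPLICIT FREE PARAMETER shared by N20's `h20 : RelWeightBound … Bad W`,
N21's `h21` and N19's core edge `hedge` on `T K ∖ Bad K t`; `RelWeightBound` alone is junk-inhabited (`Bad := ∅`, `W := 0`), its content is
only joint with `hedge`.  So whoever proves the N20 estimate at the keys must first FIX the bad class there.  `T4WeightBudget`'s reading:
«`Bad K t ⊆ T K` is the class of terms carrying OLD PENDING large-field structure (older than `K − j⋆(K)`)» ([LF-II] p.384 (1.80), p.386–387
(1.85)–(1.89): the factors `exp(−κ_j(Z) − 2p₀(g_{j(Z)}))` of the components `Z` of the large-field regions `Z_j = Λ_jᶜ`, indexed by the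
level `j(Z)` of their first region).  In the (2.18) index `(Ω_1, …, Ω_k; Λ_1, …, Λ_k)` ([III] p.257) a large-field region at level `j` is
`Λ_j ≠ T_η`; on the coupling-free key `x = (Ω, Λ)` of `TwoRunSiteKey` this is a property of `x.2` alone.  This file types exactly that
predicate, with the cut level `jcut` DISPLAYED (the recent-scale depth `j⋆(K)`, i.e. `jcut = K − j⋆(K)`, is the ESTIMATE's policy, not
fixed here), and the bookkeeping an estimate at the keys needs:
* §1 `KeyOldLargeField jcut x := ∃ j, 1 ≤ j ∧ j ≤ jcut ∧ x.2 j ≠ univ` on any key space `(ℕ → Set α) × (ℕ → Set α)`; monotone in `jcut`;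
  for the forgetful key of an ADMISSIBLE index it reads `∃ j ≤ jcut, Λ_j ≠ T_η`, and `Λ_j = T_η` forces `Ω_j = T_η` ((2.1) `Λ_j ⊆ Ω_j`);
  off the window it is an artefact (`Λ_j = ∅` for `j > k`), so consumers take `jcut ≤ k`; the no-large-field index `Seq.top` is never old-bad;
* §2 at node U5d's keys: run A — `KeyOldLargeField jcut (kA s) ↔ ∃ j ≤ jcut, s.Λ_j ≠ T_η` (definitional); run B — `KeyOldLargeField jcut (kB s')`
  reads `blockDownSet (s'.Λ_{j+1}) ≠ T_η`, which IMPLIES `s'.Λ_{j+1} ≠ T_η` (contrapositive of `blockDownSet_univ`): every run-B term in the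
  keyed fibre over a bad key carries an old large field ONE LEVEL UP — the direction a weight bound on the bad fibre consumes; the section is
  exact: `(liftSeq s).Λ_{j+1} ≠ T_η ↔ s.Λ_j ≠ T_η` (`blockUpSet S = T_η ↔ S = T_η`, `blockDown` onto), and `kB (liftSeq s)` is old-bad iff
  `kA s` is (they are the same key, `twoRunKeyB_liftSeq`);
* §3 the bad key class `badKeys T jcut := T.filter (KeyOldLargeField jcut)` and its σ-packed form over `Σ K, SiteSeqKey F (K₀ + K)` with a
  level policy `jcut : ℕ → ℕ` — `⊆ T` (the `bad_subset` clause of `RelWeightBound` for free, for every `t`), membership, monotone in the policy,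
  empty at policy `0`.
What it does NOT do: no weight, no estimate, no choice of `j⋆`; NE7b (the relative weight of these classes is `< 1` and summable over `K`) is
NOT PRINTED for `d = 4` and NOT proved; nothing of Bałaban's is asserted; no node count moves (typed 28∕28 · discharged 5∕27); N19 ∕ N20 ∕ N21
∕ N27 NOT discharged; no `sorry`, no `axiom`, no `instance`, no `notation`; one finite four-torus programme at fixed `ε` — NOT ℝ⁴, NOT OS,
NOT a mass gap, NOT the Clay problem.
-/

noncomputable section

open scoped BigOperators

namespace Literature.MathematicalPhysics.QuantumFieldTheory.Balaban1983to89.Node00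

open T4Continuum B14.Eq213MaximalDomains B15Eq112TorusCover B14DomainGeom B14.Eq218Concrete

/-! ## §1  The key-level predicate «an old large-field region» -/

section KeyPred

variable {α : Type*}

/-- **AN OLD LARGE-FIELD REGION ON THE KEY**: the second sequence of the key (the small-field regions `Λ_j`) is NOT the whole lattice at some
level `1 ≤ j ≤ jcut` — i.e. the large-field region `Z_j = Λ_jᶜ` is non-empty at a level at most `jcut`.  The cut level is a parameter.
[cite: Balaban1989LargeFieldII, (1.80) p.384; Balaban1988Convergent, (2.18) p.257 (bookkeeping)] -/
def KeyOldLargeField (jcut : ℕ) (x : (ℕ → Set α) × (ℕ → Set α)) : Prop :=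
  ∃ j, 1 ≤ j ∧ j ≤ jcut ∧ x.2 j ≠ Set.univ

/-- Unfolding. [cite: Balaban1988Convergent, (2.18) p.257 (bookkeeping)] -/
theorem keyOldLargeField_iff (jcut : ℕ) (x : (ℕ → Set α) × (ℕ → Set α)) :
    KeyOldLargeField jcut x ↔ ∃ j, 1 ≤ j ∧ j ≤ jcut ∧ x.2 j ≠ Set.univ :=
  Iff.rfl

/-- The complement: NO old large-field region — `Λ_j = T_η` at every level `1 ≤ j ≤ jcut`. [cite: Balaban1989LargeFieldI, (0.2) p.176 (bookkeeping)] -/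
theorem not_keyOldLargeField_iff (jcut : ℕ) (x : (ℕ → Set α) × (ℕ → Set α)) :
    ¬ KeyOldLargeField jcut x ↔ ∀ j, 1 ≤ j → j ≤ jcut → x.2 j = Set.univ := by
  simp only [KeyOldLargeField, not_exists, not_and, not_not]

/-- Monotone in the cut level: an old region below `jcut` is old below every `jcut' ≥ jcut`. [cite: Balaban1989LargeFieldII, (1.80) p.384 (bookkeeping)] -/
theorem KeyOldLargeField.mono {jcut jcut' : ℕ} (h : jcut ≤ jcut') {x : (ℕ → Set α) × (ℕ → Set α)} (hx : KeyOldLargeField jcut x) :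
    KeyOldLargeField jcut' x := by
  obtain ⟨j, h1, hj, hne⟩ := hx
  exact ⟨j, h1, hj.trans h, hne⟩

/-- At cut level `0` nothing is old. [cite: Balaban1989LargeFieldII, (1.80) p.384 (bookkeeping)] -/
theorem not_keyOldLargeField_zero (x : (ℕ → Set α) × (ℕ → Set α)) : ¬ KeyOldLargeField 0 x := by
  rintro ⟨j, h1, hj, -⟩
  omega

/-- One more level: old below `jcut + 1` iff old below `jcut` or `Λ_{jcut+1} ≠ T_η`. [cite: Balaban1989LargeFieldII, (1.80) p.384 (bookkeeping)] -/
theorem keyOldLargeField_succ_iff (jcut : ℕ) (x : (ℕ → Set α) × (ℕ → Set α)) :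
    KeyOldLargeField (jcut + 1) x ↔ KeyOldLargeField jcut x ∨ x.2 (jcut + 1) ≠ Set.univ := by
  constructor
  · rintro ⟨j, h1, hj, hne⟩
    rcases Nat.lt_or_ge j (jcut + 1) with hlt | hge
    · exact Or.inl ⟨j, h1, by omega, hne⟩
    · obtain rfl : j = jcut + 1 := le_antisymm hj hge
      exact Or.inr hne
  · rintro (h | h)
    · exact h.mono (Nat.le_succ _)
    · exact ⟨jcut + 1, by omega, le_rfl, h⟩

variable {D : ℕ → Set (Set α)} {k : ℕ}

/-- **ON THE FORGETFUL KEY OF AN ADMISSIBLE INDEX**: old-bad iff `Λ_j ≠ T_η` at some level `j ≤ jcut`. [cite: Balaban1988Convergent, (2.18) p.257 (bookkeeping)] -/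
theorem keyOldLargeField_seqKey_iff (jcut : ℕ) (s : Seq D k) :
    KeyOldLargeField jcut (seqKey s) ↔ ∃ j, 1 ≤ j ∧ j ≤ jcut ∧ s.Λ j ≠ Set.univ :=
  Iff.rfl

/-- `Λ_j = T_η` forces `Ω_j = T_η` on the window ((2.1): `Λ_j ⊆ Ω_j`): «no large field at level `j`» is a statement about `Λ_j` alone.
[cite: Balaban1988Convergent, (2.1) p.254 (bookkeeping)] -/
theorem seq_Ω_eq_univ_of_Λ_eq_univ (s : Seq D k) {j : ℕ} (h1 : 1 ≤ j) (hj : j ≤ k) (h : s.Λ j = Set.univ) : s.Ω j = Set.univ :=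
  Set.eq_univ_of_univ_subset (h ▸ s.chain.Λ_subset j h1 hj)

/-- Hence a key with no old large-field region has `Ω_j = Λ_j = T_η` at every level `j ≤ jcut` of the window. [cite: Balaban1988Convergent, (2.1) p.254 (bookkeeping)] -/
theorem seq_Ω_eq_univ_of_not_keyOldLargeField {jcut : ℕ} (s : Seq D k) (hx : ¬ KeyOldLargeField jcut (seqKey s)) {j : ℕ} (h1 : 1 ≤ j)
    (hj : j ≤ jcut) (hjk : j ≤ k) : s.Ω j = Set.univ :=
  seq_Ω_eq_univ_of_Λ_eq_univ s h1 hjk ((not_keyOldLargeField_iff jcut _).1 hx j h1 hj)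

/-- **OFF THE WINDOW THE PREDICATE IS AN ARTEFACT**: an index of length `k < jcut` has `Λ_{k+1} = ∅ ≠ T_η` (the (2.18) normalisation), so its
key is «old-bad» for a trivial reason — consumers take `jcut ≤ k`. [cite: Balaban1988Convergent, (2.18) p.257 (bookkeeping)] -/
theorem keyOldLargeField_seqKey_of_lt [Nonempty α] {jcut : ℕ} (s : Seq D k) (hk : k < jcut) : KeyOldLargeField jcut (seqKey s) := by
  refine ⟨k + 1, by omega, hk, ?_⟩
  show s.Λ (k + 1) ≠ Set.univ
  rw [s.Λ_off (k + 1) (by omega)]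
  exact Set.empty_ne_univ

/-- **THE NO-LARGE-FIELD INDEX IS NEVER OLD-BAD** (on the window): `Seq.top` has `Λ_j = T_η` for all `j ≤ k`. [cite: Balaban1989LargeFieldI, (0.2) p.176 (bookkeeping)] -/
theorem not_keyOldLargeField_seqKey_top (huniv : ∀ j, 1 ≤ j → j ≤ k → (Set.univ : Set α) ∈ D j) {jcut : ℕ} (hj : jcut ≤ k) :
    ¬ KeyOldLargeField jcut (seqKey (Seq.top D k huniv)) := by
  rw [not_keyOldLargeField_iff]
  intro j h1 hjc
  show (Seq.top D k huniv).Λ j = Set.univ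
  simp [Seq.top, h1, hjc.trans hj]

end KeyPred

/-! ## §2  At node U5d's keys: run A, run B, and the section -/

variable (F : T4Family)

/-- **RUN A**: the key of a run-A index is old-bad iff the index has a large-field region at some level `j ≤ jcut` (definitional).
[cite: Balaban1988Convergent, (2.18) p.257 (bookkeeping)] -/
theorem keyOldLargeField_twoRunKeyA_iff (ν : Stage7Numerics) (M : ℕ) (gA : ℕ → ℝ) (K k jcut : ℕ) (s : SeqOfRecord F ν M gA K k) :
    KeyOldLargeField jcut (twoRunKeyA F ν M gA K k s) ↔ ∃ j, 1 ≤ j ∧ j ≤ jcut ∧ s.Λ j ≠ Set.univ :=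
  Iff.rfl

/-- **RUN B** (window, `jcut ≤ k`): the key of a run-B index is old-bad iff the BLOCK-DOWN image of some `Λ_{j+1}`, `j ≤ jcut`, is not the whole
cutoff-`K` torus. [cite: Balaban1988Convergent, (2.18) p.257 (bookkeeping)] -/
theorem keyOldLargeField_twoRunKeyB_iff (ν : Stage7Numerics) {M : ℕ} (hM : 0 < M) (gB : ℕ → ℝ) (K k : ℕ) {jcut : ℕ} (hj : jcut ≤ k)
    (s' : SeqOfRecord F ν M gB (K + 1) (k + 1)) :
    KeyOldLargeField jcut (twoRunKeyB F ν hM gB K k s') ↔ ∃ j, 1 ≤ j ∧ j ≤ jcut ∧ blockDownSet F K (s'.Λ (j + 1)) ≠ Set.univ := by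
  refine exists_congr fun j => ?_
  refine ⟨fun ⟨h1, hjc, hne⟩ => ⟨h1, hjc, ?_⟩, fun ⟨h1, hjc, hne⟩ => ⟨h1, hjc, ?_⟩⟩
  · rwa [twoRunKeyB_snd F ν hM gB K k s' h1 (hjc.trans hj)] at hne
  · rwa [twoRunKeyB_snd F ν hM gB K k s' h1 (hjc.trans hj)]

/-- A set whose block-down image is not the whole torus is not the whole torus. [cite: Balaban1987RG1, (0.3) p.252 (bookkeeping)] -/
theorem ne_univ_of_blockDownSet_ne_univ (K : ℕ) {S : Set (Site (F.P (K + 1)) 0)} (h : blockDownSet F K S ≠ Set.univ) : S ≠ Set.univ := by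
  rintro rfl
  exact h (blockDownSet_univ F K)

/-- **EVERY RUN-B TERM IN THE FIBRE OVER AN OLD-BAD KEY CARRIES AN OLD LARGE FIELD ONE LEVEL UP**: if `kB s'` is old-bad below `jcut ≤ k` then
`s'.Λ_{j+1} ≠ T_η` for some `j ≤ jcut` — the direction a weight bound on the bad fibre consumes. [cite: Balaban1989LargeFieldII, (1.80) p.384; Balaban1988Convergent, (2.18) p.257 (bookkeeping)] -/
theorem exists_Λ_succ_ne_univ_of_keyOldLargeField_twoRunKeyB (ν : Stage7Numerics) {M : ℕ} (hM : 0 < M) (gB : ℕ → ℝ) (K k : ℕ) {jcut : ℕ}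
    (hj : jcut ≤ k) (s' : SeqOfRecord F ν M gB (K + 1) (k + 1)) (h : KeyOldLargeField jcut (twoRunKeyB F ν hM gB K k s')) :
    ∃ j, 1 ≤ j ∧ j ≤ jcut ∧ s'.Λ (j + 1) ≠ Set.univ := by
  obtain ⟨j, h1, hjc, hne⟩ := (keyOldLargeField_twoRunKeyB_iff F ν hM gB K k hj s').1 h
  exact ⟨j, h1, hjc, ne_univ_of_blockDownSet_ne_univ F K hne⟩

/-- Conversely a run-B term with NO large field at the levels `2, …, jcut+1` has a key with no old region below `jcut`. [cite: Balaban1989LargeFieldI, (0.2) p.176 (bookkeeping)] -/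
theorem not_keyOldLargeField_twoRunKeyB_of_forall (ν : Stage7Numerics) {M : ℕ} (hM : 0 < M) (gB : ℕ → ℝ) (K k : ℕ) {jcut : ℕ}
    (hj : jcut ≤ k) (s' : SeqOfRecord F ν M gB (K + 1) (k + 1)) (h : ∀ j, 1 ≤ j → j ≤ jcut → s'.Λ (j + 1) = Set.univ) :
    ¬ KeyOldLargeField jcut (twoRunKeyB F ν hM gB K k s') := by
  intro hx
  obtain ⟨j, h1, hjc, hne⟩ := (keyOldLargeField_twoRunKeyB_iff F ν hM gB K k hj s').1 hx
  rw [h j h1 hjc] at hne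
  exact hne (blockDownSet_univ F K)

/-- The block-up of a set is the whole torus iff the set is (`blockDown` is onto). [cite: Balaban1987RG1, (0.3) p.252 (bookkeeping)] -/
theorem blockUpSet_eq_univ_iff (K : ℕ) (S : Set (Site (F.P K) 0)) : blockUpSet F K S = Set.univ ↔ S = Set.univ := by
  constructor
  · intro h
    rw [← blockDownSet_blockUpSet F K S, h]
    exact blockDownSet_univ F K
  · rintro rfl
    rfl

/-- **THE SECTION IS EXACT ON LARGE-FIELD REGIONS**: the lift of a run-A index has a large field at level `j+1` iff the index has one at level `j`
(window). [cite: Balaban1988Convergent, (2.18) p.257 (bookkeeping)] -/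
theorem liftSeq_Λ_succ_ne_univ_iff (ν : Stage7Numerics) {M : ℕ} (hM : 0 < M) {gA gB : ℕ → ℝ} {K k : ℕ} (hR : RAgree F ν gA gB k)
    (s : Seq (DOfRecord F ν M gA K) k) {j : ℕ} (h1 : 1 ≤ j) (hj : j ≤ k) :
    (liftSeq F ν hM hR s).Λ (j + 1) ≠ Set.univ ↔ s.Λ j ≠ Set.univ := by
  rw [liftSeq_Λ_succ F ν hM hR s h1 hj, Ne, blockUpSet_eq_univ_iff]

/-- … and its key is old-bad iff the run-A key is (they are the SAME key, `twoRunKeyB_liftSeq`). [cite: Balaban1988Convergent, (2.18) p.257 (bookkeeping)] -/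
theorem keyOldLargeField_twoRunKeyB_liftSeq_iff (ν : Stage7Numerics) {M : ℕ} (hM : 0 < M) {gA gB : ℕ → ℝ} {K k : ℕ} (hR : RAgree F ν gA gB k)
    (jcut : ℕ) (s : SeqOfRecord F ν M gA K k) :
    KeyOldLargeField jcut (twoRunKeyB F ν hM gB K k (liftSeq F ν hM hR s)) ↔ KeyOldLargeField jcut (twoRunKeyA F ν M gA K k s) := by
  rw [twoRunKeyB_liftSeq F ν hM hR s]

/-! ## §3  The bad key class of a class set, and its σ-packed form -/

section BadKeys

variable {α : Type*}

/-- **THE BAD KEY CLASS** of a finite class set `T` of keys: the keys with an old large-field region below `jcut` (filtered with the classical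
decidability of the predicate, spelled explicitly — no instance is declared). [cite: Balaban1989LargeFieldII, (1.80) p.384; King1986, (3.10) p.656 (bookkeeping)] -/
def badKeys (T : Finset ((ℕ → Set α) × (ℕ → Set α))) (jcut : ℕ) : Finset ((ℕ → Set α) × (ℕ → Set α)) :=
  @Finset.filter _ (KeyOldLargeField jcut) (fun _ => Classical.propDecidable _) T

/-- Membership in the bad key class. [cite: Balaban1989LargeFieldII, (1.80) p.384 (bookkeeping)] -/
theorem mem_badKeys_iff (T : Finset ((ℕ → Set α) × (ℕ → Set α))) (jcut : ℕ) (x : (ℕ → Set α) × (ℕ → Set α)) :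
    x ∈ badKeys T jcut ↔ x ∈ T ∧ KeyOldLargeField jcut x := by
  classical
  exact Finset.mem_filter

/-- The bad key class consists of classes (`RelWeightBound.bad_subset`'s clause). [cite: King1986, (3.10) p.656 (bookkeeping)] -/
theorem badKeys_subset (T : Finset ((ℕ → Set α) × (ℕ → Set α))) (jcut : ℕ) : badKeys T jcut ⊆ T := fun _ hx =>
  ((mem_badKeys_iff T jcut _).1 hx).1

/-- Monotone in the cut level. [cite: Balaban1989LargeFieldII, (1.80) p.384 (bookkeeping)] -/
theorem badKeys_mono (T : Finset ((ℕ → Set α) × (ℕ → Set α))) {jcut jcut' : ℕ} (h : jcut ≤ jcut') : badKeys T jcut ⊆ badKeys T jcut' := by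
  intro x hx
  rw [mem_badKeys_iff] at hx ⊢
  exact ⟨hx.1, hx.2.mono h⟩

/-- At cut level `0` the bad key class is empty. [cite: Balaban1989LargeFieldII, (1.80) p.384 (bookkeeping)] -/
theorem badKeys_zero (T : Finset ((ℕ → Set α) × (ℕ → Set α))) : badKeys T 0 = ∅ :=
  Finset.eq_empty_of_forall_notMem fun x hx => not_keyOldLargeField_zero x ((mem_badKeys_iff T 0 x).1 hx).2

/-- The good class `T ∖ badKeys` consists of the keys of `T` with no old large-field region. [cite: King1986, (3.10) p.656 (bookkeeping)] -/
theorem mem_sdiff_badKeys_iff [DecidableEq ((ℕ → Set α) × (ℕ → Set α))] (T : Finset ((ℕ → Set α) × (ℕ → Set α))) (jcut : ℕ)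
    (x : (ℕ → Set α) × (ℕ → Set α)) :
    x ∈ T \ badKeys T jcut ↔ x ∈ T ∧ ¬ KeyOldLargeField jcut x := by
  rw [Finset.mem_sdiff, mem_badKeys_iff]
  tauto

end BadKeys

/-- **THE σ-PACKED BAD KEY CLASS** at N19's keyed faces (index type `Σ K, SiteSeqKey F (K₀ + K)`): the keys whose second component has an old
large-field region below the LEVEL POLICY `jcut K` of their own cutoff `K` (for NE7b: `jcut K = K₀ + K − j⋆(K)`, `j⋆` the recent-scale depth — a
parameter here). [cite: Balaban1989LargeFieldII, (1.80) p.384; King1986, (3.10) p.656 (bookkeeping)] -/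
def badKeysSigma {K₀ : ℕ} (T : Finset (Σ K, SiteSeqKey F (K₀ + K))) (jcut : ℕ → ℕ) : Finset (Σ K, SiteSeqKey F (K₀ + K)) :=
  @Finset.filter _ (fun x => KeyOldLargeField (jcut x.1) x.2) (fun _ => Classical.propDecidable _) T

/-- Membership in the σ-packed bad key class. [cite: Balaban1989LargeFieldII, (1.80) p.384 (bookkeeping)] -/
theorem mem_badKeysSigma_iff {K₀ : ℕ} (T : Finset (Σ K, SiteSeqKey F (K₀ + K))) (jcut : ℕ → ℕ) (x : Σ K, SiteSeqKey F (K₀ + K)) :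
    x ∈ badKeysSigma F T jcut ↔ x ∈ T ∧ KeyOldLargeField (jcut x.1) x.2 := by
  classical
  exact Finset.mem_filter

/-- The σ-packed bad key class consists of classes. [cite: King1986, (3.10) p.656 (bookkeeping)] -/
theorem badKeysSigma_subset {K₀ : ℕ} (T : Finset (Σ K, SiteSeqKey F (K₀ + K))) (jcut : ℕ → ℕ) : badKeysSigma F T jcut ⊆ T := fun _ hx =>
  ((mem_badKeysSigma_iff F T jcut _).1 hx).1

/-- **THE `bad_subset` CLAUSE OF `RelWeightBound` FOR THE KEYED BAD CLASS**, for every class-set family `T : ℕ → Finset _` and every source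
strength: `Bad K t := badKeysSigma (T K) jcut ⊆ T K`. [cite: King1986, (3.10) p.656 (bookkeeping)] -/
theorem badKeysSigma_bad_subset {K₀ : ℕ} (T : ℕ → Finset (Σ K, SiteSeqKey F (K₀ + K))) (jcut : ℕ → ℕ) (l₀ : ℝ) :
    ∀ (K : ℕ) (t : ℝ), |t| ≤ l₀ → badKeysSigma F (T K) jcut ⊆ T K :=
  fun K _ _ => badKeysSigma_subset F (T K) jcut

/-- **RUN A's TERM AT A BAD σ-KEY IS BAD**: if the σ-packed run-A key `⟨K, kA s⟩` lies in the bad key class then `s` has a large-field region at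
some level `j ≤ jcut K`. [cite: Balaban1989LargeFieldII, (1.80) p.384; Balaban1988Convergent, (2.18) p.257 (bookkeeping)] -/
theorem exists_Λ_ne_univ_of_mem_badKeysSigma_twoRunKeyA (ν : Stage7Numerics) (M : ℕ) (gA : ℕ → ℝ) {K₀ : ℕ}
    (T : Finset (Σ K, SiteSeqKey F (K₀ + K))) (jcut : ℕ → ℕ) (K k : ℕ) (s : SeqOfRecord F ν M gA (K₀ + K) k)
    (h : (⟨K, twoRunKeyA F ν M gA (K₀ + K) k s⟩ : Σ K, SiteSeqKey F (K₀ + K)) ∈ badKeysSigma F T jcut) :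
    ∃ j, 1 ≤ j ∧ j ≤ jcut K ∧ s.Λ j ≠ Set.univ :=
  ((mem_badKeysSigma_iff F T jcut _).1 h).2

/-- **RUN B's FIBRE OVER A BAD σ-KEY CONSISTS OF TERMS WITH AN OLD LARGE FIELD ONE LEVEL UP** (policy within the window, `jcut K ≤ k`).
[cite: Balaban1989LargeFieldII, (1.80) p.384; Balaban1988Convergent, (2.18) p.257 (bookkeeping)] -/
theorem exists_Λ_succ_ne_univ_of_mem_badKeysSigma_twoRunKeyB (ν : Stage7Numerics) {M : ℕ} (hM : 0 < M) (gB : ℕ → ℝ) {K₀ : ℕ}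
    (T : Finset (Σ K, SiteSeqKey F (K₀ + K))) (jcut : ℕ → ℕ) (K k : ℕ) (hj : jcut K ≤ k) (s' : SeqOfRecord F ν M gB (K₀ + K + 1) (k + 1))
    (h : (⟨K, twoRunKeyB F ν hM gB (K₀ + K) k s'⟩ : Σ K, SiteSeqKey F (K₀ + K)) ∈ badKeysSigma F T jcut) :
    ∃ j, 1 ≤ j ∧ j ≤ jcut K ∧ s'.Λ (j + 1) ≠ Set.univ :=
  exists_Λ_succ_ne_univ_of_keyOldLargeField_twoRunKeyB F ν hM gB (K₀ + K) k hj s' ((mem_badKeysSigma_iff F T jcut _).1 h).2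

/-- **A GOOD σ-KEY's RUN-A TERM HAS NO OLD LARGE FIELD**: `Ω_j = Λ_j = T_η` at every level `j ≤ jcut K` of the window.
[cite: Balaban1989LargeFieldI, (0.2) p.176; Balaban1988Convergent, (2.1) p.254 (bookkeeping)] -/
theorem Λ_eq_univ_of_mem_sdiff_badKeysSigma_twoRunKeyA (ν : Stage7Numerics) (M : ℕ) (gA : ℕ → ℝ) {K₀ : ℕ}
    [DecidableEq (Σ K, SiteSeqKey F (K₀ + K))] (T : Finset (Σ K, SiteSeqKey F (K₀ + K))) (jcut : ℕ → ℕ) (K k : ℕ)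
    (s : SeqOfRecord F ν M gA (K₀ + K) k)
    (h : (⟨K, twoRunKeyA F ν M gA (K₀ + K) k s⟩ : Σ K, SiteSeqKey F (K₀ + K)) ∈ T \ badKeysSigma F T jcut)
    {j : ℕ} (h1 : 1 ≤ j) (hj : j ≤ jcut K) : s.Λ j = Set.univ ∧ (j ≤ k → s.Ω j = Set.univ) := by
  rw [Finset.mem_sdiff, mem_badKeysSigma_iff] at h
  have hgood : ¬ KeyOldLargeField (jcut K) (twoRunKeyA F ν M gA (K₀ + K) k s) := fun hx => h.2 ⟨h.1, hx⟩
  have hΛ : s.Λ j = Set.univ := (not_keyOldLargeField_iff _ _).1 hgood j h1 hj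
  exact ⟨hΛ, fun hjk => seq_Ω_eq_univ_of_Λ_eq_univ s h1 hjk hΛ⟩

end Literature.MathematicalPhysics.QuantumFieldTheory.Balaban1983to89.Node00

end
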